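import Summits.QuantumFields.BalabanUV.T4Continuum.Spine.NE9.TowerCarriersKing
import Literature.MathematicalPhysics.QuantumFieldTheory.Balaban1983to89.T4GoodClassBudget

/-!
# T⁴ programme, spine estimate NE9 — KING'S WINDOW IS ADAPTIVE: the rate-only window slot of node U5b (the recent DEVIATION of the
# term constants, cell hazard H-U5b-1) passes with a QUALITATIVE E-side profile `b_j → 0` because King's organisation frees the
# recent window from the logarithmic constraint — census item C40 of cell `pub-balaban-gaps`, seat ne9 (gen 11)

Cell `pub-balaban-gaps` (YM blitz G2, seat ne9, unit `pub-balaban-gaps-ne9-g11`; record `run/shared/lean/pub/pub-balaban-gaps/ne/NE9.md`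
§5 row C40).  Summits-side bookkeeping over the tree's node-U5b vocabulary (`T4GoodClassBudget`: `RecentOnly`, `WindowMultiplicity`,
`windowSum`, `jstarOf`, `jlogOf`; `T4RecentScale.sum_profile_le_of_slices`) and this seat's E-side profile of the tower of carriers
(`TowerCarriersKing`).  NO definition; nothing of Bałaban's asserted.

WHY.  In the cell's node-U5 design the E-side enters the per-term budget (`T4MatchingClosure.ReindexedBudget`) in TWO slots: the recent
RADIUS `r_K` (field-dependent part; booked against the PRINTED size branch by node U4′'s crossover — King's currency passes it by dominated
convergence, this seat's `DirectPairingCrossover`, census C39) and the recent DEVIATION `s_K` of the term CONSTANTS (cell hazard H-U5b-1,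
`T4GoodClassBudget.RecentDeviation` ∕ `abs_sum_dev_le_windowSum`): every degree of freedom created in the recent window `j⋆(K) ≤ j ≤ K` shifts
the term's field-independent constant (the vacuum-energy subtractions `E^{(j)}(X, 1; g⃗)` of the affected domains, term-dependent —
[Balaban1988Convergent] p. 262 «The constant E_k (depending on {Ω_j}, {Λ_j} also)») by `|e_i| ≤ Cs·(θ^{sc i} + δ_{sc i})·w_i`, and the slot is
RATE-ONLY: the one-run constants are NOT small, so there is NO size branch — the budget is the window sum `Σ_{j=j⋆}^{K} RATE_j·Λ^{K−j}`
(`sum_rate_le_windowSum`), small only because the two-run rate `θ^j` is geometric and the window is short (`jlogOf`: `K − j⋆(K) = ⌈C log(K+1)⌉`,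
forced in the CONSECUTIVE currency by the summability of the bad-class weight `(K+1)^{−C(−log r₀)}`, `C(−log r₀) > 1`; or `jstarOf`: linear).  The
two-run discrepancy of `E^{(j)}(X, 1; g⃗)` is node U3's bracket at the trivial background: NE5 + NE9's history bracket.  In King's currency the
E-side offers only a profile `b_j → 0` there (§17 rows 1–5 of `NE9.md`).  QUESTION (C40): does `Σ_{j=j⋆(K)}^{K} b_j·Λ^{K−j} → 0`?  On the log
window it does NOT in general (`b_{j⋆}·(K+1)^{C log Λ}`); is King's qualitative currency dead at node U5b after all?

ANSWER (kernel, this file): NO — KING's WINDOW IS ADAPTIVE.  King's organisation needs the bad-class weight only to TEND TO ZERO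
(`DirectPairingApexDesign.kingMatching_of_design`: `W_K → 0`), not to be summable, so the window width `m(K) = K − j⋆(K)` is free to grow
ARBITRARILY SLOWLY; choosing it ADAPTED to the profile makes the rate-only window sum tend to zero while the bad-class budget `V·r₀^{m(K)}` still
tends to zero.
* §1 `exists_diagonal`: the diagonal choice — countably many null sequences `f N K → 0` (`K → ∞`) and a cap `cap K → ∞` admit an index
  `m K → ∞`, `m K ≤ cap K`, with `f (m K) K → 0` (thresholds + `Nat.findGreatest`).
* §2 `sum_profile_le_windowSum`: the King form of `T4GoodClassBudget.sum_rate_le_windowSum` — recent-only dofs with window multiplicity and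
  per-dof deviations `≤ b_{sc i}·w_i` give `Σ_i b_{sc i} w_i ≤ Cw·vol·Σ_{j∈[j⋆,K]} b_jΛ^{K−j}` (`T4RecentScale.sum_profile_le_of_slices` BY NAME);
  `tendsto_windowSum_fixed`: a window of FIXED width `N` has `Σ_{j=K−N}^{K} b_jΛ^{K−j} → 0` for every `b → 0` and every `Λ`.
* §3 `exists_adaptedWindow`: for every profile `b → 0`, every `Λ`, and every cap `cap K → ∞` (the linear cap `⌈σK⌉` that the OTHER rate-only
  kinds with geometric rates impose, `T4GoodClassBudget.windowSum_le`), there is a window `m K → ∞`, `m K ≤ cap K`, with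
  `Σ_{j=K−m(K)}^{K} b_jΛ^{K−j} → 0`; `tendsto_badBudget_of_window`: along ANY window `m K → ∞` the bad-class budget `V·r₀^{m K}` (`0 ≤ r₀ < 1`;
  the shape of `T4MatchingClosure.relWeightBound_of_slotDom_log`'s `S K = V·r^{K − j⋆(K)}`) tends to zero; `exists_kingWindow`: both at once.
* §4 `king_window_of_carriers`: the E-side profile of `TowerCarriersKing.king_U6_of_carriers` feeds §3 BY NAME.
* §5 TWO-SIDED.  `linearWindow_not_tendsto`: a FIXED unbounded window not adapted to the profile fails — the linear window `m(K) = K∕2`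
  (`jstarOf ½`-type, `T4MatchingAssembly` §7's banked cut) with `Λ = 2`, `b_j = 1∕(j+1) → 0`: at `K = 2n` the `j = n` term is `2ⁿ∕(n+1) ≥ 1`;
  (the log window `jlogOf C` fails likewise for `b_j = 1∕log(j+2)`: `(K+1)^{C log Λ}∕log K → ∞` — recorded, not typed);
  `boundedWindow_badBudget_not_tendsto`: a BOUNDED window keeps the bad-class budget `≥ V·r₀^M > 0`.  So the window must tend to infinity
  (bad class) but slowly relative to `b` (deviation): the ADAPTIVITY — available in King's organisation (`W_K → 0`), unavailable in the
  consecutive one (`Σ W_K < ∞` forces `m(K) ≥ C log(K+1)`) — is load-bearing.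

VERDICT FOR THE ROW (census C40).  King's qualitative currency passes node U5b's rate-only deviation slot H-U5b-1 for the E-kind by an ADAPTED
window; together with C39 (radius slot via the crossover) every slot of node U5's per-term budget through which NE9's history bracket enters
(`recent_remainder`, `recent_deviation`) is reached from «a scale profile `b_j → 0`» with no modulus, no constant, no rate, no `Summable` — the
prices being the PRINTED size branch (C39) and the adaptive window (C40, an organisational freedom, no estimate).  HONEST RESIDUE: the other
rate-only kinds on the window (pending ∕ insert ∕ boundary, `T4RecentScale.Kind`) keep their geometric rates (NE2∕NE3-type η-rates, not E-side
history) and impose the linear cap honoured by `exists_adaptedWindow`; the per-pair producers for runs `n` apart stay the T4-DAG owner's;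
instance 0∕1.  CLASSIFICATION OF NE9 UNCHANGED: WORK-bound (W1).

HONEST FRAMING: bookkeeping for rung (B)+1 on ONE FIXED finite four-torus; elementary real analysis on hypothesis SHAPES (H-U5b-1, NE7b's bad-class
budget, tower-NE5 — the cell's located new estimates, none in print for Bałaban's d = 4 procedure); NE9 NOT PRINTED ∕ NOT PROVED; spine PROVED 0∕9
unchanged; NOT UV stability, NOT the continuum limit, NOT infinite volume, NOT a mass gap, NOT Clay.  HONEST DEPENDENCY: continuum YM on T⁴ ⇐
BetaPertH ∧ nine spine estimates (0∕9 proved); BetaPertH ⇐ (D1) ∧ (D4) ∧ CAP+tail.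

References (TYPES only): [Balaban1988Convergent] = T. Bałaban, Commun. Math. Phys. **119** (1988) 243–285, p. 262; [King1986] = C. King, Commun.
Math. Phys. **102** (1986) 649–677, Thm 3.4 (3.9) p. 656, p. 657.
-/

namespace Summit.QuantumFields.BalabanUV.T4Continuum.NE9.DirectPairingWindow

open scoped BigOperators
open Finset Filter Topology
open Literature.MathematicalPhysics.QuantumFieldTheory.Balaban1983to89
open Literature.MathematicalPhysics.QuantumFieldTheory.Balaban1983to89.T4CouplingAnalyticity (BoxWindow)
open T4GoodClassBudget (RecentOnly WindowMultiplicity)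
open Summit.QuantumFields.BalabanUV.T4Continuum.NE9.TowerCarriers
open Summit.QuantumFields.BalabanUV.T4Continuum.NE9.TowerCarriersBox (TowerNE5On)

/-! ## §1 The diagonal choice -/

/-- **DIAGONAL CHOICE.**  Countably many null sequences `f N K → 0` (`K → ∞`, each `N`) and a cap `cap K → ∞`: there is an index
`m K → ∞` with `m K ≤ cap K` and `f (m K) K → 0`.  Thresholds `T N` (`|f N K| ≤ 1∕(N+1)` beyond) and `G N` (`N ≤ cap K` beyond), their
monotone envelope `S N = Σ_{i≤N} (T i + G i)`, and `m K = max {N ≤ K : S N ≤ K}` (`Nat.findGreatest`). [folklore] -/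
theorem exists_diagonal {f : ℕ → ℕ → ℝ} {cap : ℕ → ℕ} (hf : ∀ N, Tendsto (f N) atTop (𝓝 0))
    (hcap : Tendsto cap atTop atTop) :
    ∃ m : ℕ → ℕ, (∀ K, m K ≤ cap K) ∧ Tendsto m atTop atTop ∧ Tendsto (fun K => f (m K) K) atTop (𝓝 0) := by
  have hT : ∀ N : ℕ, ∃ K₀ : ℕ, ∀ K, K₀ ≤ K → |f N K| ≤ 1 / ((N : ℝ) + 1) := fun N => by
    obtain ⟨K₀, hK₀⟩ := Metric.tendsto_atTop.mp (hf N) (1 / ((N : ℝ) + 1)) (by positivity)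
    refine ⟨K₀, fun K hK => ?_⟩
    have h := hK₀ K hK
    rw [Real.dist_eq, sub_zero] at h
    exact h.le
  have hG : ∀ N : ℕ, ∃ K₀ : ℕ, ∀ K, K₀ ≤ K → N ≤ cap K := fun N => tendsto_atTop_atTop.mp hcap N
  choose T hT using hT
  choose G hG using hG
  -- monotone envelope of the thresholds
  set S : ℕ → ℕ := fun N => ∑ i ∈ range (N + 1), (T i + G i) with hS
  have hSTG : ∀ N, T N + G N ≤ S N := fun N =>
    single_le_sum (f := fun i => T i + G i) (fun i _ => Nat.zero_le _) (self_mem_range_succ N)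
  -- the diagonal index
  set m : ℕ → ℕ := fun K => Nat.findGreatest (fun N => S N ≤ K) K with hm
  have hspec : ∀ K, S 0 ≤ K → S (m K) ≤ K := fun K hK =>
    Nat.findGreatest_spec (P := fun N => S N ≤ K) (Nat.zero_le K) hK
  have hm_top : Tendsto m atTop atTop := by
    rw [tendsto_atTop_atTop]
    intro N
    exact ⟨max (S N) N, fun K hK =>
      Nat.le_findGreatest (P := fun N => S N ≤ K) ((le_max_right _ _).trans hK) ((le_max_left _ _).trans hK)⟩
  refine ⟨m, fun K => ?_, hm_top, ?_⟩
  · -- the cap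
    by_cases h0 : m K = 0
    · rw [h0]; exact Nat.zero_le _
    · have hP : S (m K) ≤ K :=
        Nat.findGreatest_of_ne_zero (P := fun N => S N ≤ K) (n := K) (m := m K) rfl h0
      exact hG (m K) K (by have := hSTG (m K); omega)
  · -- `|f (m K) K| ≤ 1/(m K + 1)` beyond `S 0`, and `1/(m K + 1) → 0`
    have h1 : Tendsto (fun K => 1 / ((m K : ℝ) + 1)) atTop (𝓝 0) :=
      tendsto_one_div_add_atTop_nhds_zero_nat.comp hm_top
    refine squeeze_zero_norm' ?_ h1
    filter_upwards [eventually_ge_atTop (S 0)] with K hK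
    rw [Real.norm_eq_abs]
    exact hT (m K) K (by have := hSTG (m K); have := hspec K hK; omega)

/-! ## §2 The King form of the window budget, and windows of fixed width -/

/-- **PROFILE ON THE WINDOW ⇒ `vol ×` KING WINDOW SUM** (the King form of `T4GoodClassBudget.sum_rate_le_windowSum`): recent-only degrees of
freedom (`RecentOnly dof sc j⋆ K`) with window multiplicity (`WindowMultiplicity dof sc w Cw vol Λ j⋆ K`) and per-dof deviations of profile shape
`|e_i| ≤ b_{sc i}·w_i` (`b ≥ 0` — King's qualitative currency in place of `Cs(θ^j + δ_j)`) give
`|Σ_i e_i| ≤ Cw·vol·Σ_{j ∈ [j⋆, K]} b_j·Λ^{K−j}` — `T4RecentScale.sum_profile_le_of_slices` BY NAME. [folklore] -/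
theorem sum_profile_le_windowSum {κ : Type*} {dof : Finset κ} {sc : κ → ℕ} {w e : κ → ℝ} {Cw vol Λ : ℝ} {b : ℕ → ℝ}
    {jstar K : ℕ} (hb0 : ∀ j, 0 ≤ b j) (hrec : RecentOnly dof sc jstar K) (hM : WindowMultiplicity dof sc w Cw vol Λ jstar K)
    (hdev : ∀ i ∈ dof, |e i| ≤ b (sc i) * w i) :
    |∑ i ∈ dof, e i| ≤ Cw * vol * ∑ j ∈ Icc jstar K, b j * Λ ^ (K - j) := by
  have hsc : ∀ i ∈ dof, sc i ∈ Icc jstar K := fun i hi => mem_Icc.mpr (hrec i hi)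
  calc |∑ i ∈ dof, e i| ≤ ∑ i ∈ dof, |e i| := abs_sum_le_sum_abs _ _
    _ ≤ ∑ i ∈ dof, b (sc i) * w i := sum_le_sum hdev
    _ ≤ ∑ j ∈ Icc jstar K, b j * (Cw * vol * Λ ^ (K - j)) :=
        T4RecentScale.sum_profile_le_of_slices (ρ := b) (M := fun j => Cw * vol * Λ ^ (K - j)) hsc (fun j _ => hb0 j)
          (fun j hj => hM j (mem_Icc.mp hj).1 (mem_Icc.mp hj).2)
    _ = Cw * vol * ∑ j ∈ Icc jstar K, b j * Λ ^ (K - j) := by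
        rw [mul_sum]
        exact sum_congr rfl fun j _ => by ring

/-- **A WINDOW OF FIXED WIDTH `N`**: `Σ_{j=K−N}^{K} b_j·Λ^{K−j} → 0` for every `b → 0` and every `Λ` — finitely many null sequences
`b_{K−i}Λ^i`, `i ≤ N` (re-indexed by `j = K − i` from `K ≥ N` on). [folklore] -/
theorem tendsto_windowSum_fixed {Λ : ℝ} {b : ℕ → ℝ} (hb : Tendsto b atTop (𝓝 0)) (N : ℕ) :
    Tendsto (fun K => ∑ j ∈ Icc (K - N) K, b j * Λ ^ (K - j)) atTop (𝓝 0) := by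
  have hre : ∀ K, N ≤ K → ∑ j ∈ Icc (K - N) K, b j * Λ ^ (K - j) = ∑ i ∈ range (N + 1), b (K - i) * Λ ^ i := by
    intro K hK
    refine sum_nbij' (fun j => K - j) (fun i => K - i) ?_ ?_ ?_ ?_ ?_
    · intro j hj
      rw [mem_Icc] at hj
      rw [mem_range]
      omega
    · intro i hi
      rw [mem_range] at hi
      rw [mem_Icc]
      omega
    · intro j hj
      rw [mem_Icc] at hj
      omega
    · intro i hi
      rw [mem_range] at hi
      omega
    · intro j hj
      rw [mem_Icc] at hj
      rw [show K - (K - j) = j by omega]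
  have hlim : Tendsto (fun K => ∑ i ∈ range (N + 1), b (K - i) * Λ ^ i) atTop (𝓝 0) := by
    have h := tendsto_finsetSum (range (N + 1))
      (fun i (_ : i ∈ range (N + 1)) => ((hb.comp (tendsto_sub_atTop_nat i)).mul_const (Λ ^ i)))
    simpa using h
  refine hlim.congr' ?_
  filter_upwards [eventually_ge_atTop N] with K hK
  exact (hre K hK).symm

/-! ## §3 The adapted window: deviation slot AND bad-class budget tend to zero -/

/-- **THE ADAPTED WINDOW.**  For every profile `b → 0`, every multiplicity base `Λ`, and every cap `cap K → ∞` there is a window width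
`m K → ∞` with `m K ≤ cap K` along which the King window sum `Σ_{j=K−m(K)}^{K} b_j·Λ^{K−j}` tends to zero (§1 on the fixed-width sums of §2).
NO rate of `b` is used. [folklore] -/
theorem exists_adaptedWindow {Λ : ℝ} {b : ℕ → ℝ} {cap : ℕ → ℕ} (hb : Tendsto b atTop (𝓝 0))
    (hcap : Tendsto cap atTop atTop) :
    ∃ m : ℕ → ℕ, (∀ K, m K ≤ cap K) ∧ Tendsto m atTop atTop ∧
      Tendsto (fun K => ∑ j ∈ Icc (K - m K) K, b j * Λ ^ (K - j)) atTop (𝓝 0) :=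
  exists_diagonal (f := fun N K => ∑ j ∈ Icc (K - N) K, b j * Λ ^ (K - j)) (fun N => tendsto_windowSum_fixed hb N) hcap

/-- **THE BAD-CLASS BUDGET ALONG ANY WINDOW TENDING TO INFINITY**: `V·r₀^{m K} → 0` for `0 ≤ r₀ < 1` and `m K → ∞` — the shape of the
weight half's budget `S K = V·r^{K − j⋆(K)}` (`T4MatchingClosure.relWeightBound_of_slotDom_log`, `T4GoodClassBudget.summable_weightMajorant_of_cut`)
with `K − j⋆(K) = m K`; King's organisation asks only this (`W_K → 0`), not `Σ_K W_K < ∞`. [folklore] -/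
theorem tendsto_badBudget_of_window {r₀ V : ℝ} (h0 : 0 ≤ r₀) (h1 : r₀ < 1) {m : ℕ → ℕ} (hm : Tendsto m atTop atTop) :
    Tendsto (fun K => V * r₀ ^ m K) atTop (𝓝 0) := by
  simpa using ((tendsto_pow_atTop_nhds_zero_of_lt_one h0 h1).comp hm).const_mul V

/-- The window cut `j⋆(K) = K − m K` has width `K − j⋆(K) = m K` when `m K ≤ K`. [folklore] -/
theorem sub_sub_window {m : ℕ → ℕ} {K : ℕ} (h : m K ≤ K) : K - (K - m K) = m K := by omega

/-- **KING's WINDOW, BOTH BUDGETS AT ONCE.**  Profile `b → 0` (the E-kind recent deviations in King's currency), bad-class rate `0 ≤ r₀ < 1`,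
`V`, multiplicity base `Λ`, and a cap `cap K → ∞` with `cap K ≤ K` (the linear cap of the geometric rate-only kinds): there is a cut
`j⋆(K) = K − m K` with `m K → ∞`, `m K ≤ cap K`, along which the deviation window sum `Σ_{j=j⋆(K)}^{K} b_jΛ^{K−j} → 0` AND the bad-class budget
`V·r₀^{K − j⋆(K)} → 0`. [folklore] -/
theorem exists_kingWindow {Λ r₀ V : ℝ} {b : ℕ → ℝ} {cap : ℕ → ℕ} (hb : Tendsto b atTop (𝓝 0)) (h0 : 0 ≤ r₀) (h1 : r₀ < 1)
    (hcap : Tendsto cap atTop atTop) (hcapK : ∀ K, cap K ≤ K) :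
    ∃ m : ℕ → ℕ, (∀ K, m K ≤ cap K) ∧ Tendsto m atTop atTop ∧
      Tendsto (fun K => ∑ j ∈ Icc (K - m K) K, b j * Λ ^ (K - j)) atTop (𝓝 0) ∧
      Tendsto (fun K => V * r₀ ^ (K - (K - m K))) atTop (𝓝 0) := by
  obtain ⟨m, hmc, hmt, hsum⟩ := exists_adaptedWindow (Λ := Λ) hb hcap
  refine ⟨m, hmc, hmt, hsum, ?_⟩
  have heq : (fun K => V * r₀ ^ (K - (K - m K))) = fun K => V * r₀ ^ m K :=
    funext fun K => by rw [sub_sub_window ((hmc K).trans (hcapK K))]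
  rw [heq]
  exact tendsto_badBudget_of_window h0 h1 hmt

/-- The half-window cap `K ↦ K ∕ 2` is admissible: it tends to infinity and stays `≤ K`. [folklore] -/
theorem halfCap_tendsto : Tendsto (fun K : ℕ => K / 2) atTop atTop ∧ ∀ K : ℕ, K / 2 ≤ K :=
  ⟨tendsto_atTop_atTop.mpr fun N => ⟨2 * N, fun K hK => by omega⟩, fun K => Nat.div_le_self K 2⟩

/-! ## §4 The E-side profile of the carriers feeds the adapted window, by name -/

/-- **KING's WINDOW FED FROM THE CARRIERS.**  Under the hypotheses of `TowerCarriersKing.king_U6_of_carriers` (tower-NE5 on the box, prefix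
dependence, separate uniform continuity per scale uniform over runs ∕ backgrounds ∕ domains, the (1.18)-type bound, run histories in the box with a
summable K-uniform consecutive matching profile): the scale profile `b_j → 0` dominating every direct bracket of the carriers (in particular at
the trivial background: the vacuum-energy constants' two-run discrepancy) admits, for every `Λ`, every bad-class rate `0 ≤ r₀ < 1`, `V`, and
every cap `cap K → ∞`, `cap K ≤ K` (e.g. `halfCap_tendsto`, or the linear cap `⌈σK⌉` of the geometric rate-only kinds), a King window along which
the deviation window sum AND the bad-class budget tend to zero. [folklore] -/
theorem king_window_of_carriers (T : TowerData) {E : ℕ → (ℕ → ℝ) → T.B → T.Dom → ℝ} {I : Set ℝ} {κ θ C₅ B : ℝ}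
    {p : ℕ → ℝ} {t : ℕ → ℕ → ℝ} (hC : 0 ≤ C₅) (hθ0 : 0 ≤ θ) (hθ1 : θ < 1) (h5 : TowerNE5On T E I κ θ C₅)
    (hP : ∀ (k : ℕ) (U : T.B) (X : T.Dom), ∀ g ∈ BoxWindow I, ∀ g' ∈ BoxWindow I,
      (∀ i, i < k - T.r X → g i = g' i) → E k g U X = E k g' U X)
    (hUC : ∀ m i : ℕ, i < m → ∀ ε : ℝ, 0 < ε → ∃ δ : ℝ, 0 < δ ∧ ∀ (k : ℕ) (U : T.B) (X : T.Dom), T.r X + m = k →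
      ∀ g ∈ BoxWindow I, ∀ g' ∈ BoxWindow I, (∀ j, j ≠ i → g j = g' j) → |g i - g' i| ≤ δ →
        Real.exp (κ * T.d X) * |E k g U X - E k g' U X| ≤ ε)
    (hB0 : 0 ≤ B) (hB : ∀ (k : ℕ) (U : T.B) (X : T.Dom), ∀ g ∈ BoxWindow I, Real.exp (κ * T.d X) * |E k g U X| ≤ B)
    (ht : ∀ K, t K ∈ BoxWindow I) (hp : ∀ K i, |t (K + 1) (i + 1) - t K i| ≤ p i) (hp0 : ∀ i, 0 ≤ p i)
    (hps : Summable p) :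
    ∃ b : ℕ → ℝ, (∀ j, 0 ≤ b j) ∧ Tendsto b atTop (𝓝 0) ∧
      (∀ (K n : ℕ) (U : T.B) (X : T.Dom), T.r X ≤ K →
        |E (K + n) (t (K + n)) U X - E K (t K) (T.descend (K + n) U K) X| ≤ b (K - T.r X) * Real.exp (-(κ * T.d X))) ∧
      ∀ (Λ r₀ V : ℝ) (cap : ℕ → ℕ), 0 ≤ r₀ → r₀ < 1 → Tendsto cap atTop atTop → (∀ K, cap K ≤ K) →
        ∃ m : ℕ → ℕ, (∀ K, m K ≤ cap K) ∧ Tendsto m atTop atTop ∧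
          Tendsto (fun K => ∑ j ∈ Icc (K - m K) K, b j * Λ ^ (K - j)) atTop (𝓝 0) ∧
          Tendsto (fun K => V * r₀ ^ (K - (K - m K))) atTop (𝓝 0) := by
  obtain ⟨b, hb0, hb, hdom, -⟩ :=
    TowerCarriersKing.king_U6_of_carriers T hC hθ0 hθ1 h5 hP hUC hB0 hB ht hp hp0 hps
  exact ⟨b, hb0, hb, hdom, fun Λ r₀ V cap h0 h1 hcap hcapK =>
    exists_kingWindow (Λ := Λ) (V := V) hb h0 h1 hcap hcapK⟩

/-! ## §5 Two-sided: a fixed window fails; a bounded window fails — the adaptivity is load-bearing -/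

/-- **A FIXED (NON-ADAPTED) UNBOUNDED WINDOW FAILS.**  The linear window `m(K) = K ∕ 2` with `Λ = 2` and the admissible profile
`b_j = 1∕(j+1) → 0`: at `K = 2n` the `j = n` term of `Σ_{j=K−K∕2}^{K} b_j·2^{K−j}` is `2ⁿ∕(n+1) ≥ 1`, so the window sum does NOT tend to zero.
(On the log window `jlogOf C` the profile `1∕log(j+2)` fails likewise — recorded in the census, not typed.) [folklore] -/
theorem linearWindow_not_tendsto :
    ¬ Tendsto (fun K : ℕ => ∑ j ∈ Icc (K - K / 2) K, 1 / ((j : ℝ) + 1) * (2 : ℝ) ^ (K - j)) atTop (𝓝 0) := by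
  intro h
  -- along `K = 2n` every value is `≥ 1`
  have hge : ∀ n : ℕ, (1 : ℝ) ≤ ∑ j ∈ Icc (2 * n - 2 * n / 2) (2 * n), 1 / ((j : ℝ) + 1) * (2 : ℝ) ^ (2 * n - j) := by
    intro n
    have hmem : n ∈ Icc (2 * n - 2 * n / 2) (2 * n) := by
      rw [mem_Icc]; omega
    have hterm : (1 : ℝ) ≤ 1 / ((n : ℝ) + 1) * (2 : ℝ) ^ (2 * n - n) := by
      rw [show 2 * n - n = n by omega, div_mul_eq_mul_div, one_mul, le_div_iff₀ (by positivity), one_mul]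
      have h2 : ((n : ℕ) : ℝ) + 1 ≤ ((2 ^ n : ℕ) : ℝ) := by exact_mod_cast Nat.lt_two_pow_self
      simpa using h2
    exact hterm.trans (single_le_sum (f := fun j : ℕ => 1 / ((j : ℝ) + 1) * (2 : ℝ) ^ (2 * n - j))
      (fun j _ => by positivity) hmem)
  have h2n : Tendsto (fun n : ℕ => 2 * n) atTop atTop :=
    tendsto_atTop_atTop.mpr fun N => ⟨N, fun n hn => by omega⟩
  have hsub := h.comp h2n
  obtain ⟨n, hn⟩ := (hsub.eventually (gt_mem_nhds (show (0 : ℝ) < 1 by norm_num))).exists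
  exact absurd (hge n) (not_le.mpr hn)

/-- **A BOUNDED WINDOW FAILS THE BAD CLASS.**  If `m K ≤ M` for all `K`, `0 < r₀ < 1` and `0 < V`, the bad-class budget `V·r₀^{m K} ≥ V·r₀^M > 0`
does NOT tend to zero: the window must tend to infinity. [folklore] -/
theorem boundedWindow_badBudget_not_tendsto {r₀ V : ℝ} (h0 : 0 < r₀) (h1 : r₀ < 1) (hV : 0 < V) {m : ℕ → ℕ} {M : ℕ}
    (hM : ∀ K, m K ≤ M) : ¬ Tendsto (fun K => V * r₀ ^ m K) atTop (𝓝 0) := by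
  intro h
  have hpos : 0 < V * r₀ ^ M := mul_pos hV (pow_pos h0 M)
  have hge : ∀ K, V * r₀ ^ M ≤ V * r₀ ^ m K := fun K =>
    mul_le_mul_of_nonneg_left (pow_le_pow_of_le_one h0.le h1.le (hM K)) hV.le
  obtain ⟨K, hK⟩ := (h.eventually (gt_mem_nhds hpos)).exists
  exact absurd (hge K) (not_le.mpr hK)

/-- … whereas the adapted window of §3 with the SAME data (`b_j = 1∕(j+1)`, `Λ = 2`, half-window cap) succeeds. [folklore] -/
theorem adaptedWindow_harmonic :
    ∃ m : ℕ → ℕ, (∀ K, m K ≤ K / 2) ∧ Tendsto m atTop atTop ∧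
      Tendsto (fun K => ∑ j ∈ Icc (K - m K) K, 1 / ((j : ℝ) + 1) * (2 : ℝ) ^ (K - j)) atTop (𝓝 0) :=
  exists_adaptedWindow (b := fun j => 1 / ((j : ℝ) + 1)) tendsto_one_div_add_atTop_nhds_zero_nat halfCap_tendsto.1


/-! ## §5b (v1.1, append-only) The tree's LOGARITHMIC window fails too: the consecutive currency's own cut does not pass a qualitative profile -/

/-- **THE CONSECUTIVE LOG WINDOW FAILS** (supersedes the «recorded, not typed» remark of §5).  On the tree's logarithmic cut
`T4GoodClassBudget.jlogOf C K = K − ⌈C·log(K+1)⌉` (here `C = 1`) — the window the CONSECUTIVE currency is forced to use (`summable_weightMajorant_log`: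
bad class `(K+1)^{−C(−log r₀)}` summable) — with `Λ = e²` and the admissible profile `b_j = 1∕(j+1) → 0`, the `j = jlog(K)` term of the rate-only window sum
`Σ_{j=jlog(K)}^{K} b_j·Λ^{K−j}` is `(e²)^{⌈log(K+1)⌉}∕(jlog(K)+1) ≥ (K+1)²∕(K+1) ≥ 1`: the window sum does NOT tend to zero.  So a qualitative E-profile passes node
U5b's deviation slot ONLY through the adaptivity of §3, which the consecutive organisation does not have. [folklore] -/
theorem logWindow_not_tendsto :
    ¬ Tendsto (fun K : ℕ => ∑ j ∈ Icc (T4GoodClassBudget.jlogOf 1 K) K,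
        1 / ((j : ℝ) + 1) * (Real.exp 2) ^ (K - j)) atTop (𝓝 0) := by
  intro h
  have hge : ∀ K : ℕ, (1 : ℝ) ≤ ∑ j ∈ Icc (T4GoodClassBudget.jlogOf 1 K) K,
      1 / ((j : ℝ) + 1) * (Real.exp 2) ^ (K - j) := by
    intro K
    have hK1 : (0 : ℝ) < (K : ℝ) + 1 := by positivity
    set w : ℕ := ⌈Real.log ((K : ℝ) + 1)⌉₊ with hw
    have hjlog : T4GoodClassBudget.jlogOf 1 K = K - w := by
      rw [T4GoodClassBudget.jlogOf, one_mul]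
    have hwK : w ≤ K := by
      rw [hw]
      refine Nat.ceil_le.mpr ?_
      have := Real.log_le_sub_one_of_pos hK1
      linarith
    have hmem : K - w ∈ Icc (T4GoodClassBudget.jlogOf 1 K) K := by
      rw [hjlog, mem_Icc]; omega
    have hlogle : Real.log ((K : ℝ) + 1) ≤ (w : ℝ) := Nat.le_ceil _
    have hterm : (1 : ℝ) ≤ 1 / (((K - w : ℕ) : ℝ) + 1) * (Real.exp 2) ^ (K - (K - w)) := by
      rw [show K - (K - w) = w by omega]
      have h1 : ((K : ℝ) + 1) ^ 2 ≤ (Real.exp 2) ^ w := by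
        have e1 : Real.exp (((2 : ℕ) : ℝ) * Real.log ((K : ℝ) + 1)) = ((K : ℝ) + 1) ^ 2 := by
          rw [Real.exp_nat_mul, Real.exp_log hK1]
        calc ((K : ℝ) + 1) ^ 2 = Real.exp (((2 : ℕ) : ℝ) * Real.log ((K : ℝ) + 1)) := e1.symm
          _ ≤ Real.exp ((w : ℝ) * 2) := Real.exp_le_exp.mpr (by push_cast; nlinarith)
          _ = (Real.exp 2) ^ w := Real.exp_nat_mul 2 w
      have h2 : (((K - w : ℕ) : ℝ) + 1) ≤ (K : ℝ) + 1 := by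
        have : ((K - w : ℕ) : ℝ) ≤ K := by exact_mod_cast Nat.sub_le K w
        linarith
      have hpos : (0 : ℝ) < ((K - w : ℕ) : ℝ) + 1 := by positivity
      rw [div_mul_eq_mul_div, one_mul, le_div_iff₀ hpos, one_mul]
      calc (((K - w : ℕ) : ℝ) + 1) ≤ (K : ℝ) + 1 := h2
        _ ≤ ((K : ℝ) + 1) ^ 2 := by nlinarith
        _ ≤ (Real.exp 2) ^ w := h1
    exact hterm.trans (single_le_sum (f := fun j : ℕ => 1 / ((j : ℝ) + 1) * (Real.exp 2) ^ (K - j))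
      (fun j _ => by positivity) hmem)
  obtain ⟨K, hK⟩ := (h.eventually (gt_mem_nhds (show (0 : ℝ) < 1 by norm_num))).exists
  exact absurd (hge K) (not_le.mpr hK)

/-- **THE THREE WINDOWS SIDE BY SIDE** on the same admissible data (`b_j = 1∕(j+1) → 0`): the linear window (`Λ = 2`) and the tree's log window (`Λ = e²`)
do not pass the rate-only deviation slot, an adapted window (`Λ = 2`, half cap) does. [folklore] -/
theorem windows_sideBySide :
    (¬ Tendsto (fun K : ℕ => ∑ j ∈ Icc (K - K / 2) K, 1 / ((j : ℝ) + 1) * (2 : ℝ) ^ (K - j)) atTop (𝓝 0)) ∧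
    (¬ Tendsto (fun K : ℕ => ∑ j ∈ Icc (T4GoodClassBudget.jlogOf 1 K) K,
        1 / ((j : ℝ) + 1) * (Real.exp 2) ^ (K - j)) atTop (𝓝 0)) ∧
    (∃ m : ℕ → ℕ, (∀ K, m K ≤ K / 2) ∧ Tendsto m atTop atTop ∧
      Tendsto (fun K => ∑ j ∈ Icc (K - m K) K, 1 / ((j : ℝ) + 1) * (2 : ℝ) ^ (K - j)) atTop (𝓝 0)) :=
  ⟨linearWindow_not_tendsto, logWindow_not_tendsto, adaptedWindow_harmonic⟩


/-! ## §6 (v1.2, append-only) Compatibility with the GEOMETRIC rate-only kinds, by name: along the adapted window their window sums stay summable -/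

/-- The linear cap `⌊σK⌋` tends to infinity for `σ > 0` and stays `≤ K` for `σ ≤ 1`. [folklore] -/
theorem linearCap_tendsto {σ : ℝ} (hσ0 : 0 < σ) (hσ1 : σ ≤ 1) :
    Tendsto (fun K : ℕ => ⌊σ * (K : ℝ)⌋₊) atTop atTop ∧ ∀ K : ℕ, ⌊σ * (K : ℝ)⌋₊ ≤ K := by
  refine ⟨?_, fun K => ?_⟩
  · refine tendsto_atTop_atTop.mpr fun N => ⟨⌈(N : ℝ) / σ⌉₊, fun K hK => ?_⟩
    have hK' : (N : ℝ) / σ ≤ K := (Nat.le_ceil _).trans (by exact_mod_cast hK)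
    have : (N : ℝ) ≤ σ * K := by
      have := mul_le_mul_of_nonneg_left hK' hσ0.le
      rwa [mul_div_cancel₀ _ hσ0.ne'] at this
    exact Nat.le_floor this
  · refine Nat.floor_le_of_le ?_
    calc σ * (K : ℝ) ≤ 1 * K := mul_le_mul_of_nonneg_right hσ1 (Nat.cast_nonneg K)
      _ = K := one_mul _

/-- **ONE ADAPTED WINDOW SERVES THE QUALITATIVE PROFILE AND THE GEOMETRIC KINDS AT ONCE** (discharges the «linear cap» proviso of §3 BY NAME).  Given a
profile `b → 0`, a geometric rate-only kind with rate `0 < θ ≤ Λ` and a cut rate `σ ∈ (0, 1]` with `θ(Λ∕θ)^σ < 1` (`T4GoodClassBudget.exists_cut`), and a bad-class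
rate `0 ≤ r₀ < 1`: there is a window `m K → ∞`, `m K ≤ ⌊σK⌋`, along which (i) the profile's window sum `Σ_{j=K−m(K)}^{K} b_jΛ^{K−j} → 0`, (ii) the bad-class budget
`V·r₀^{K−(K−m K)} → 0`, and (iii) the geometric kind's window sum `T4GoodClassBudget.windowSum θ Λ (K − m K) K` is SUMMABLE over `K` (hence `→ 0`) —
`T4GoodClassBudget.summable_windowSum` BY NAME, whose only requirement on the cut is `K − j⋆(K) ≤ σK + 1`. [folklore] -/
theorem exists_kingWindow_geometric {Λ θ σ r₀ V : ℝ} {b : ℕ → ℝ} (hb : Tendsto b atTop (𝓝 0))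
    (hθ : 0 < θ) (hθΛ : θ ≤ Λ) (hσ0 : 0 < σ) (hσ1 : σ ≤ 1) (hq : θ * (Λ / θ) ^ σ < 1)
    (h0 : 0 ≤ r₀) (h1 : r₀ < 1) :
    ∃ m : ℕ → ℕ, (∀ K, m K ≤ ⌊σ * (K : ℝ)⌋₊) ∧ Tendsto m atTop atTop ∧
      Tendsto (fun K => ∑ j ∈ Icc (K - m K) K, b j * Λ ^ (K - j)) atTop (𝓝 0) ∧
      Tendsto (fun K => V * r₀ ^ (K - (K - m K))) atTop (𝓝 0) ∧
      Summable (fun K => T4GoodClassBudget.windowSum θ Λ (K - m K) K) ∧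
      Tendsto (fun K => T4GoodClassBudget.windowSum θ Λ (K - m K) K) atTop (𝓝 0) := by
  obtain ⟨hcap, hcapK⟩ := linearCap_tendsto hσ0 hσ1
  obtain ⟨m, hmc, hmt, hsum, hbad⟩ := exists_kingWindow (Λ := Λ) (V := V) hb h0 h1 hcap hcapK
  have hwin : ∀ K : ℕ, (((K - (K - m K) : ℕ) : ℝ)) ≤ σ * K + 1 := fun K => by
    have hmK : m K ≤ K := (hmc K).trans (hcapK K)
    rw [sub_sub_window hmK]
    have h1' : ((m K : ℕ) : ℝ) ≤ ((⌊σ * (K : ℝ)⌋₊ : ℕ) : ℝ) := by exact_mod_cast hmc K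
    have h2' : ((⌊σ * (K : ℝ)⌋₊ : ℕ) : ℝ) ≤ σ * K := Nat.floor_le (by positivity)
    linarith
  have hS := T4GoodClassBudget.summable_windowSum hθ hθΛ hq hwin
  exact ⟨m, hmc, hmt, hsum, hbad, hS, hS.tendsto_atTop_zero⟩

/-- … and such a cut rate exists for every `0 < θ < 1`, `θ ≤ Λ` (`T4GoodClassBudget.exists_cut` BY NAME), so the proviso is no restriction. [folklore] -/
theorem exists_kingWindow_geometric' {Λ θ r₀ V : ℝ} {b : ℕ → ℝ} (hb : Tendsto b atTop (𝓝 0)) (hθ : 0 < θ) (hθ1 : θ < 1)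
    (hθΛ : θ ≤ Λ) (h0 : 0 ≤ r₀) (h1 : r₀ < 1) :
    ∃ σ : ℝ, 0 < σ ∧ σ ≤ 1 ∧ ∃ m : ℕ → ℕ, (∀ K, m K ≤ ⌊σ * (K : ℝ)⌋₊) ∧ Tendsto m atTop atTop ∧
      Tendsto (fun K => ∑ j ∈ Icc (K - m K) K, b j * Λ ^ (K - j)) atTop (𝓝 0) ∧
      Tendsto (fun K => V * r₀ ^ (K - (K - m K))) atTop (𝓝 0) ∧
      Summable (fun K => T4GoodClassBudget.windowSum θ Λ (K - m K) K) := by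
  obtain ⟨σ, hσ0, hσ1, hq⟩ := T4GoodClassBudget.exists_cut hθ hθ1 hθΛ
  obtain ⟨m, hmc, hmt, hsum, hbad, hS, -⟩ := exists_kingWindow_geometric (V := V) hb hθ hθΛ hσ0 hσ1 hq h0 h1
  exact ⟨σ, hσ0, hσ1, m, hmc, hmt, hsum, hbad, hS⟩

end Summit.QuantumFields.BalabanUV.T4Continuum.NE9.DirectPairingWindow
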